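import Summits.Ventures.PercRepro.Night2FatDegCount
import Summits.Ventures.PercRepro.Night2FatXIndepLevels

/-!
# night-2: the fat count from an unloaded family AND unloaded singletons, all levels

**`basis_pair_fair_of_family_and_singletons`**: a lossy basis pair has the fair share as soon as
`1 ≤ fatTerm 1 c₁ + |E| · fatTerm 2 c₂ + ∑_{j = 3}^{N} #{Y ∈ W′^{(j−1)} : P Y} · fatTerm j c_j`, where the targets
`Q ∪ {x, y}` (`y ∈ E`) and `Q ∪ {x} ∪ Y` (`P Y`) are unloaded and `c_j = 1` when `N − j ≤ 3`, `11/18` otherwise.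
The levels `1, 2, 3, …, N` are `Finset.Icc 1 N`; level `1` is always unloaded (`dload_eq_zero_of_card_sdiff_le_six`).
Paper `proofs/NIGHT-2-g35.md` §2.
-/

namespace PercRepro.Shadow

open PercRepro.ThmH PercRepro.PerFlat

variable {α : Type*} [DecidableEq α] {M : Matroid α} [M.Finite] {G : Finset α}

/-- The `1`-subsets of `W` inside `E ⊆ W` number `|E|`. -/
theorem card_filter_powersetCard_one_subset {W E : Finset α} (hE : E ⊆ W) :
    ((W.powersetCard 1).filter (fun Y => Y ⊆ E)).card = E.card := by
  have heq : (W.powersetCard 1).filter (fun Y => Y ⊆ E) = E.powersetCard 1 := by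
    ext Y
    rw [Finset.mem_filter, Finset.mem_powersetCard, Finset.mem_powersetCard]
    constructor
    · rintro ⟨⟨-, h1⟩, hYE⟩
      exact ⟨hYE, h1⟩
    · rintro ⟨hYE, h1⟩
      exact ⟨⟨hYE.trans hE, h1⟩, hYE⟩
  rw [heq, Finset.card_powersetCard, Nat.choose_one_right]

/-- **The fair share from an unloaded family `P` at the levels `≥ 3` and unloaded singletons `E` at level `2`.** -/
theorem basis_pair_fair_of_family_and_singletons (hG : G ∈ flatsQ M (5 + 1)) (hd : (gr M \ G).card = 2)
    (hk : kColoops M G = 1) (hs : ∀ e ∈ gr M, ∀ f ∈ gr M, e ≠ f → rkN M {e, f} = 2)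
    (hl : ∀ e ∈ gr M, M.Indep {e}) (hfat : (fatClosures M 5 G 2).card ≤ 1)
    {B₀ : Finset α} (hB₀ : B₀ ∈ thinMembers M 5 G) {w₀ x : α} (hD : G \ clF M B₀ = {w₀, x}) (hne : w₀ ≠ x)
    {B : Finset α} (hB : B ∈ thinMembers M 5 G) (hnP : ¬ bigP M G B) {z : α} (hz : z ∈ G \ clF M B)
    (hl0 : loss M 5 G B z ≠ 0) (hw₀ : w₀ ∈ insert z B) (hx : x ∉ insert z B) (hN3 : 3 ≤ (G \ insert z B).card)
    (P : Finset α → Prop) [DecidablePred P]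
    (hP : ∀ T ∈ tgtSets M 5 G B z, x ∈ T → 3 ≤ (T \ insert z B).card → P ((T \ insert z B).erase x) →
      dload M 5 G (bigP M G) (dshGT2 M 5 G) T = 0)
    {E : Finset α} (hE : E ⊆ (G \ insert z B).erase x)
    (hEun : ∀ T ∈ tgtSets M 5 G B z, x ∈ T → (T \ insert z B).card = 2 → (T \ insert z B).erase x ⊆ E →
      dload M 5 G (bigP M G) (dshGT2 M 5 G) T = 0)
    (hnum : (1 : ℚ) ≤ fatTerm 1 (if (G \ insert z B).card - 1 ≤ 3 then 1 else 11 / 18) +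
      (E.card : ℚ) * fatTerm 2 (if (G \ insert z B).card - 2 ≤ 3 then 1 else 11 / 18) +
      ∑ j ∈ Finset.Icc 3 (G \ insert z B).card,
        (((((G \ insert z B).erase x).powersetCard (j - 1)).filter P).card : ℚ) *
          fatTerm j (if (G \ insert z B).card - j ≤ 3 then 1 else 11 / 18)) :
    loss M 5 G B z ≤ rhoL M 5 G B z * lossIncomeH M 5 G (bigP M G) (dshGT2 M 5 G) B z := by
  have hd' : (gr M \ G).card ≤ 5 := by omega
  have hxG : x ∈ G \ insert z B := by
    refine Finset.mem_sdiff.2 ⟨?_, hx⟩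
    have : x ∈ G \ clF M B₀ := by
      rw [hD]
      exact Finset.mem_insert_of_mem (Finset.mem_singleton_self _)
    exact (Finset.mem_sdiff.1 this).1
  set N := (G \ insert z B).card with hNdef
  set W' := (G \ insert z B).erase x with hW'
  set F := (tgtSets M 5 G B z).filter (fun T => x ∈ T ∧ dload M 5 G (bigP M G) (dshGT2 M 5 G) T = 0) with hF
  have hg0 : ∀ T ∈ F, 0 ≤ capS M 5 G T / ((221 / 360 : ℚ) * ((2 * ((T \ coloops M G).card - 2).choose 4 : ℕ) : ℚ)) :=
    fun T _ => div_nonneg (capS_nonneg' hG hd' T) (by positivity)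
  apply basis_pair_fair_of_fat_count_sum hG hd hk hs hl hfat hB₀ hD hne hB hnP hz hl0 hw₀ hx
  -- the level sums
  have hsum := sum_levels_le_sum hg0 (fun T => (T \ insert z B).card) (Finset.Icc 1 N)
  have hIcc : Finset.Icc 1 N = insert 1 (insert 2 (Finset.Icc 3 N)) := by
    ext j
    simp only [Finset.mem_Icc, Finset.mem_insert]
    omega
  have h1n : (1 : ℕ) ∉ insert 2 (Finset.Icc 3 N) := by simp
  have h2n : (2 : ℕ) ∉ Finset.Icc 3 N := by simp
  rw [hIcc, Finset.sum_insert h1n, Finset.sum_insert h2n] at hsum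
  -- level `1`
  have hl1 := fat_count_level_ge' hG hd hk hB hnP hz hxG (j := 1) (by norm_num)
    (fun T hT _ h1 => dload_eq_zero_of_card_sdiff_le_six hG hd hk hs hl
      (by rw [card_sdiff_coloops_eq_level_add_five hG hd hk hB hnP hz hT, h1]))
  simp only [Nat.sub_self, Nat.choose_zero_right, Nat.cast_one, one_mul] at hl1
  -- level `2`: the singletons inside `E`
  have hl2 := fat_count_level_ge_family hG hd hk hB hnP hz hxG (fun Y => Y ⊆ E) (j := 2) (by norm_num)
    (fun T hT hxT h2 hYE => hEun T hT hxT h2 hYE)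
  rw [card_filter_powersetCard_one_subset hE] at hl2
  -- the levels `≥ 3`
  have hlj : ∀ j ∈ Finset.Icc 3 N, ((((W'.powersetCard (j - 1)).filter P).card : ℕ) : ℚ) *
      fatTerm j (if N - j ≤ 3 then 1 else 11 / 18) ≤
      ∑ T ∈ F.filter (fun T => (T \ insert z B).card = j),
        capS M 5 G T / ((221 / 360 : ℚ) * ((2 * ((T \ coloops M G).card - 2).choose 4 : ℕ) : ℚ)) := by
    intro j hj
    rw [Finset.mem_Icc] at hj
    exact fat_count_level_ge_family hG hd hk hB hnP hz hxG P (by omega)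
      (fun T hT hxT hj' hPY => hP T hT hxT (by omega) hPY)
  have hsumj := Finset.sum_le_sum hlj
  linarith

end PercRepro.Shadow
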